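import Literature.Probability.LatticeModels.TorusTwoPointLimit
import Literature.Probability.LatticeModels.InfraredBoundProofs
import Literature.Probability.LatticeModels.CriticalTwoPointBounds
import Literature.Probability.LatticeModels.MessagerMiracleSoleFree
import Literature.Probability.LatticeModels.IsingTranslationInvariance
import HarnessLib

/-!
# The gradient estimate for the two-point function from reflection positivity
# (Duminil-Copin–Panis 2025, eq. (1.11); Aizenman–Duminil-Copin 2021, §5)

Topic `Literature/Probability/LatticeModels`; theorems only (no definition, no named fact).

For the nearest-neighbour Ising model on `ℤ^d` with `β ≥ 0` and vanishing spontaneous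
magnetisation (`m*(β) = 0`: all `β < β_c`, and `β = β_c` for `d ≥ 3`), write
`G(x) = ⟨σ₀σ_x⟩^f_β` (`twoPointFree`). Duminil-Copin–Panis, CMP 406 (2025), arXiv:2404.05700, use
in the proofs of Theorems 1.3 and 1.8 the **gradient estimate** (their (1.11) and its footnote):
"using the spectral representation of the Ising model, for all `x_⊥ ∈ ℤ^{d-1}`, there exists a
measure `μ` on `[0,1]` such that for all `k ≥ 1`, `⟨τ₀τ_{(k,x_⊥)}⟩_β = ∫₀¹ λ^k dμ(λ)` … The estimate
(1.11) follows by telescoping and replacing `kλ^k(1-λ)` by `Cλ^{k/2}`". We prove the per-step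
form consumed by `Literature.Barriers.CriticalPhenomena.NNIsing.not_bubbleCondition_of_dcp`,

  `G(x) - G(x + e_i) ≤ G(j e_i) / (x_i - j + 1)`   for all `x ∈ ℤ^d` and `0 ≤ j ≤ x_i`

(`twoPointFree_gradient_estimate`, and at `β_c` for `d ≥ 3`,
`twoPointFree_criticalBeta_gradient_estimate`), WITHOUT the spectral theorem: reflection
positivity of the torus Gibbs measures through sites and through bonds
(`isingTorus_reflectionPositive_sites/bonds_holds`, Fröhlich–Israel–Lieb–Simon 1978) applied to
linear spin observables `F = ∑ c_u σ_u` gives positive semi-definiteness of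
`(u, v) ↦ ⟨σ_{θu} σ_v⟩` on each half-torus (`torus_rp_linear_sites/bonds`); letting the torus grow
(`abs_isingTorusTwoPoint_sub_plusCorr_le_of_spontaneousMagnetization_eq_zero`, the
Lebowitz–Martin-Löf identification of the free and plus states when `m* = 0`) transfers it to `G`
(`twoPointFree_rp_sites/bonds`). For `F = τ₀ ± τ_{x_⊥}` translated along the axis this yields that
the sequences `q^±_k = 2G(ke_i) ± (G(ke_i + x_⊥) + G(ke_i - x_⊥))` are nonnegative and CONVEX
(site reflections give the even, bond reflections the odd centres); a convex bounded sequence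
is nonincreasing and its increments obey `q_k - q_{k+1} ≤ q_j/(k - j + 1)`
(`sub_succ_le_div_of_convex`), which is the displayed estimate with `G(ke_i + x_⊥) = (q⁺_k - q⁻_k)/4`
and the Messager–Miracle-Solé bound `G(je_i + x_⊥) ≤ G(je_i)`.

## References

* H. Duminil-Copin, R. Panis, Comm. Math. Phys. 406 (2025), arXiv:2404.05700, eq. (1.11) and
  footnote 2 [DuminilCopinPanis2025LowerBounds].
* J. Fröhlich, R. Israel, E. Lieb, B. Simon, Comm. Math. Phys. 62 (1978), §2 [FILS1978].
* A. Messager, S. Miracle-Solé, J. Stat. Phys. 17 (1977) 245 [MessagerMiracleSoleJSP1977].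
-/

noncomputable section

open MeasureTheory Filter Finset
open scoped BigOperators Topology

namespace Literature.Probability.LatticeModels

namespace DCPGradient

/-! ### Convex bounded sequences -/

/-- A convex sequence bounded above is nonincreasing. [folklore] -/
theorem succ_le_of_convex_bdd {q : ℕ → ℝ} (hconv : ∀ k, 2 * q (k + 1) ≤ q k + q (k + 2))
    {B : ℝ} (hB : ∀ k, q k ≤ B) (k : ℕ) : q (k + 1) ≤ q k := by
  by_contra hlt
  push Not at hlt
  set δ : ℝ := q (k + 1) - q k with hδ
  have hδ0 : 0 < δ := by rw [hδ]; linarith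
  -- increments stay above `δ`
  have hinc : ∀ m : ℕ, δ ≤ q (k + m + 1) - q (k + m) := by
    intro m
    induction m with
    | zero => simp [hδ]
    | succ m ih =>
        have hc := hconv (k + m)
        rw [show k + (m + 1) + 1 = k + m + 2 by ring, show k + (m + 1) = k + m + 1 by ring]
        linarith
  -- hence linear growth
  have hgrow : ∀ m : ℕ, q k + m * δ ≤ q (k + m) := by
    intro m
    induction m with
    | zero => simp
    | succ m ih =>
        have := hinc m
        rw [show k + (m + 1) = k + m + 1 by ring]
        push_cast
        linarith
  obtain ⟨m, hm⟩ := exists_nat_gt ((B - q k) / δ)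
  have h1 := hgrow m
  have h2 := hB (k + m)
  rw [div_lt_iff₀ hδ0] at hm
  linarith

/-- Increments of a convex nonincreasing nonnegative sequence: `q_k - q_{k+1} ≤ q_j/(k - j + 1)`
for `j ≤ k` (the increments are nonincreasing, so `(k-j+1)(q_k - q_{k+1}) ≤ q_j - q_{k+1} ≤ q_j`).
[folklore] -/
theorem sub_succ_le_div_of_convex {q : ℕ → ℝ} (hconv : ∀ k, 2 * q (k + 1) ≤ q k + q (k + 2))
    (hq0 : ∀ k, 0 ≤ q k) {j k : ℕ} (hjk : j ≤ k) :
    q k - q (k + 1) ≤ q j / ((k : ℝ) - j + 1) := by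
  -- `(m+1) Δ_{j+m} ≤ q_j - q_{j+m+1}`
  have key : ∀ m : ℕ, ((m : ℝ) + 1) * (q (j + m) - q (j + m + 1)) ≤ q j - q (j + m + 1) := by
    intro m
    induction m with
    | zero => simp
    | succ m ih =>
        have hc := hconv (j + m)
        rw [show j + (m + 1) + 1 = j + m + 2 by ring, show j + (m + 1) = j + m + 1 by ring]
        push_cast
        nlinarith
  obtain ⟨m, rfl⟩ : ∃ m, k = j + m := ⟨k - j, by omega⟩
  have h := key m
  have hpos : (0 : ℝ) < ((j + m : ℕ) : ℝ) - j + 1 := by push_cast; linarith [(Nat.cast_nonneg m : (0 : ℝ) ≤ m)]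
  rw [le_div_iff₀ hpos]
  push_cast
  have : ((j : ℝ) + m - j + 1) = (m : ℝ) + 1 := by ring
  rw [this]
  linarith [hq0 (j + m + 1)]

/-! ### Reflection positivity on the torus for linear spin observables -/

section Torus

variable {d L : ℕ} [NeZero L]

/-- Spins evaluated in the positive half are measurable for the half σ-algebra. [folklore] -/
theorem measurable_spinAt_positiveEvents {V : Type*} {Vpos : Set V} {u : V} (hu : u ∈ Vpos) :
    Measurable[positiveEvents (S := ℤˣ) Vpos] (spinAt u) :=
  (measurable_of_countable (fun z : ℤˣ => ((z : ℤ) : ℝ))).comp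
    (measurable_cylinderEvent_apply (X := fun _ : V => ℤˣ) hu)

/-- Expansion of `∫ F(θσ) F(σ) dμ_{𝕋}` for a linear spin observable `F = ∑_j c_j σ_{u_j}` on the
torus: `∑_{j,l} c_j c_l ⟨σ_{θ u_j} σ_{u_l}⟩_{𝕋}`. [folklore] -/
theorem integral_reflect_linear (θ : TorusSite d L ≃ TorusSite d L) (β h : ℝ) {ι : Type*}
    (s : Finset ι) (c : ι → ℝ) (u : ι → TorusSite d L) :
    ∫ σ, (∑ j ∈ s, c j * spinAt (u j) (configReflect θ σ)) * (∑ j ∈ s, c j * spinAt (u j) σ)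
        ∂(isingTorusMeasure d L β h) =
      ∑ j ∈ s, ∑ l ∈ s, c j * c l * isingTorusTwoPoint d L β h (θ (u j)) (u l) := by
  have hrefl : ∀ (σ : SpinConfig (TorusSite d L)) (j : ι), spinAt (u j) (configReflect θ σ) = spinAt (θ (u j)) σ :=
    fun σ j => rfl
  have hint : (fun σ : SpinConfig (TorusSite d L) =>
      (∑ j ∈ s, c j * spinAt (u j) (configReflect θ σ)) * (∑ j ∈ s, c j * spinAt (u j) σ)) =
      fun σ => ∑ j ∈ s, ∑ l ∈ s, (c j * c l) * spinPair (θ (u j)) (u l) σ := by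
    funext σ
    simp_rw [hrefl σ]
    rw [Finset.sum_mul_sum]
    refine Finset.sum_congr rfl fun j _ => Finset.sum_congr rfl fun l _ => ?_
    rw [spinPair]; ring
  rw [hint]
  change isingExpect (torusGraph d L) Finset.univ β h .free
      (fun σ => ∑ j ∈ s, ∑ l ∈ s, (c j * c l) * spinPair (θ (u j)) (u l) σ) = _
  rw [isingExpect_finset_sum' (torusGraph d L) Finset.univ h .free β s _
    (fun j => Finset.measurable_sum _ fun l _ => (measurable_spinPair _ _).const_mul _)]
  refine Finset.sum_congr rfl fun j _ => ?_
  rw [isingExpect_finset_sum' (torusGraph d L) Finset.univ h .free β s _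
    (fun l => (measurable_spinPair _ _).const_mul _)]
  refine Finset.sum_congr rfl fun l _ => ?_
  rw [isingExpect_const_mul' (torusGraph d L) Finset.univ h .free β _ (measurable_spinPair _ _)]
  rfl

/-- **Reflection positivity through sites for linear spin observables**: on the torus
`(ℤ/Lℤ)^d`, `L` even, `β ≥ 0`, for sites `u_j` in the half-torus of the reflection `θ` through the
hyperplane `x_i = k`, the matrix `⟨σ_{θ u_j} σ_{u_l}⟩_{𝕋_L;β,h}` is positive semi-definite
(Fröhlich–Israel–Lieb–Simon 1978, §2, applied to `F = ∑ c_j σ_{u_j}`). [cite: FILS1978, §2] -/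
theorem torus_rp_linear_sites (hL : Even L) (i : Fin d) (k : ZMod L) {β : ℝ} (hβ : 0 ≤ β) (h : ℝ)
    {ι : Type*} (s : Finset ι) (c : ι → ℝ) (u : ι → TorusSite d L)
    (hu : ∀ j ∈ s, u j ∈ Torus.halfThroughSites i k) :
    0 ≤ ∑ j ∈ s, ∑ l ∈ s, c j * c l *
      isingTorusTwoPoint d L β h (Torus.reflectThroughSites i k (u j)) (u l) := by
  have hRP := (isingTorus_reflectionPositive_sites_holds (d := d) (L := L) hL i k hβ h).real
  set F : SpinConfig (TorusSite d L) → ℝ := fun σ => ∑ j ∈ s, c j * spinAt (u j) σ with hF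
  have hmeas : Measurable[positiveEvents (S := ℤˣ) (Torus.halfThroughSites i k)] F :=
    Finset.measurable_sum s fun j hj => (measurable_spinAt_positiveEvents (hu j hj)).const_mul (c j)
  have hbdd : ∃ C, ∀ σ, ‖F σ‖ ≤ C := by
    refine ⟨∑ j ∈ s, |c j|, fun σ => ?_⟩
    rw [Real.norm_eq_abs, hF]
    refine (Finset.abs_sum_le_sum_abs _ _).trans (Finset.sum_le_sum fun j _ => ?_)
    rw [abs_mul]
    have : |spinAt (u j) σ| = 1 := by
      rcases spinAt_eq_one_or_eq_neg_one (u j) σ with h1 | h1 <;> simp [h1]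
    rw [this, mul_one]
  have := hRP F hmeas hbdd
  rwa [hF, integral_reflect_linear] at this

/-- **Reflection positivity through bonds for linear spin observables**: as
`torus_rp_linear_sites`, for the reflection `x_i ↦ 2k + 1 - x_i` through the hyperplane bisecting
the bonds `{k, k+1}` and sites in its positive half (Fröhlich–Israel–Lieb–Simon 1978, §2,
ferromagnetic nearest-neighbour coupling). [cite: FILS1978, §2] -/
theorem torus_rp_linear_bonds (hL : Even L) (i : Fin d) (k : ZMod L) {β : ℝ} (hβ : 0 ≤ β) (h : ℝ)
    {ι : Type*} (s : Finset ι) (c : ι → ℝ) (u : ι → TorusSite d L)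
    (hu : ∀ j ∈ s, u j ∈ Torus.halfBetweenSites i k) :
    0 ≤ ∑ j ∈ s, ∑ l ∈ s, c j * c l *
      isingTorusTwoPoint d L β h (Torus.reflectBetweenSites i k (u j)) (u l) := by
  have hRP := (isingTorus_reflectionPositive_bonds_holds (d := d) (L := L) hL i k hβ h).real
  set F : SpinConfig (TorusSite d L) → ℝ := fun σ => ∑ j ∈ s, c j * spinAt (u j) σ with hF
  have hmeas : Measurable[positiveEvents (S := ℤˣ) (Torus.halfBetweenSites i k)] F :=
    Finset.measurable_sum s fun j hj => (measurable_spinAt_positiveEvents (hu j hj)).const_mul (c j)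
  have hbdd : ∃ C, ∀ σ, ‖F σ‖ ≤ C := by
    refine ⟨∑ j ∈ s, |c j|, fun σ => ?_⟩
    rw [Real.norm_eq_abs, hF]
    refine (Finset.abs_sum_le_sum_abs _ _).trans (Finset.sum_le_sum fun j _ => ?_)
    rw [abs_mul]
    have : |spinAt (u j) σ| = 1 := by
      rcases spinAt_eq_one_or_eq_neg_one (u j) σ with h1 | h1 <;> simp [h1]
    rw [this, mul_one]
  have := hRP F hmeas hbdd
  rwa [hF, integral_reflect_linear] at this

end Torus

/-! ### Transfer to `ℤ^d` when `m*(β) = 0` -/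

section Infinite

variable {d : ℕ}

/-- The periodic two-point functions converge to `⟨σ₀σ_{b-a}⟩^f_β` when `m*(β) = 0`, pair by
pair, uniformly on a finite set of pairs: for every `ε > 0` there is `N₀` such that for all
`N ≥ N₀` and all listed pairs, `|⟨σ_{ā}σ_{b̄}⟩_{𝕋_N} - G(b - a)| ≤ ε`
(`abs_isingTorusTwoPoint_sub_plusCorr_le_of_spontaneousMagnetization_eq_zero` with the
Lebowitz–Martin-Löf identification `⟨·⟩⁺ = ⟨·⟩^f` and translation invariance).
[cite: AizenmanDuminilCopinAnnals2021, arXiv:1912.07973 Prop. 5.2 (p. 17)] -/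
theorem torus_pairs_converge {β : ℝ} (hβ : 0 ≤ β) (hm : spontaneousMagnetization d β = 0)
    {κ : Type*} (t : Finset κ) (a b : κ → Site d) {ε : ℝ} (hε : 0 < ε) :
    ∃ N₀ : ℕ, ∀ N : ℕ, N₀ ≤ N → ∀ [NeZero N], ∀ p ∈ t,
      |isingTorusTwoPoint d N β 0 (Torus.proj N (a p)) (Torus.proj N (b p)) -
        twoPointFree d β (b p - a p)| ≤ ε := by
  classical
  -- per pair
  have hpair : ∀ p : κ, ∃ N₀ : ℕ, ∀ N : ℕ, N₀ ≤ N → ∀ [NeZero N],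
      |isingTorusTwoPoint d N β 0 (Torus.proj N (a p)) (Torus.proj N (b p)) -
        twoPointFree d β (b p - a p)| ≤ ε := by
    intro p
    by_cases hab : a p = b p
    · refine ⟨0, fun N _ _ => ?_⟩
      rw [hab, sub_self, twoPointFree_zero, isingTorusTwoPoint, isingTwoPoint_self, sub_self, abs_zero]
      exact hε.le
    · obtain ⟨N₀, hN₀⟩ :=
        abs_isingTorusTwoPoint_sub_plusCorr_le_of_spontaneousMagnetization_eq_zero hβ hm hab hε
      refine ⟨N₀, fun N hN _ => ?_⟩
      have hne : b p - a p ≠ 0 := sub_ne_zero.2 (Ne.symm hab)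
      have hid : plusCorr d β 0 {a p, b p} = twoPointFree d β (b p - a p) := by
        have hmap : ({a p, b p} : Finset (Site d)) =
            ({(0 : Site d), b p - a p} : Finset (Site d)).map (Site.shift (a p)).toEmbedding := by
          rw [Finset.map_insert, Finset.map_singleton]
          simp [Site.shift]
        rw [← freeCorr_eq_plusCorr_of_spontaneousMagnetization_eq_zero hβ hm, twoPointFree_eq_freeCorr β hne,
          hmap, freeCorr_shift d hβ le_rfl]
      rw [← hid]
      exact hN₀ N hN
  choose N₀ hN₀ using hpair
  refine ⟨t.sup N₀, fun N hN _ p hp => hN₀ p N (le_trans (Finset.le_sup hp) hN)⟩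

/-- Coordinates of projected sites with small nonnegative `i`-th coordinate lie in the site
half-torus `{(x_i - 0).val ≤ N/2}`. [folklore] -/
theorem proj_mem_halfThroughSites {N : ℕ} [NeZero N] (i : Fin d) {x : Site d} (h0 : 0 ≤ x i)
    (hx : 2 * x i ≤ N) : Torus.proj N x ∈ Torus.halfThroughSites i (0 : ZMod N) := by
  change (Torus.proj N x i - 0).val ≤ N / 2
  rw [sub_zero, Torus.proj_apply]
  have hN : N ≠ 0 := NeZero.ne N
  have hlt : x i < N := by omega
  have hval : (((x i : ℤ) : ZMod N)).val = (x i).toNat := by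
    have h := ZMod.val_intCast (n := N) (x i)
    rw [Int.emod_eq_of_lt h0 hlt] at h
    omega
  rw [hval]
  omega

/-- The same for the bond half-torus `{1 ≤ (x_i - 0).val ≤ N/2}`. [folklore] -/
theorem proj_mem_halfBetweenSites {N : ℕ} [NeZero N] (i : Fin d) {x : Site d} (h1 : 1 ≤ x i)
    (hx : 2 * x i ≤ N) : Torus.proj N x ∈ Torus.halfBetweenSites i (0 : ZMod N) := by
  change 1 ≤ (Torus.proj N x i - 0).val ∧ (Torus.proj N x i - 0).val ≤ N / 2
  rw [sub_zero, Torus.proj_apply]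
  have hN : N ≠ 0 := NeZero.ne N
  have hlt : x i < N := by omega
  have hval : (((x i : ℤ) : ZMod N)).val = (x i).toNat := by
    have h := ZMod.val_intCast (n := N) (x i)
    rw [Int.emod_eq_of_lt (by omega) hlt] at h
    omega
  rw [hval]
  omega

/-- The torus reflection through the sites `x_i = 0` is the projection of `axisRefl i 0`. [folklore] -/
theorem reflectThroughSites_proj {N : ℕ} (i : Fin d) (x : Site d) :
    Torus.reflectThroughSites i (0 : ZMod N) (Torus.proj N x) = Torus.proj N (axisRefl i 0 x) := by
  funext j
  simp only [Torus.reflectThroughSites_apply, Torus.proj_apply, Function.update_apply, axisRefl_apply]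
  by_cases hj : j = i
  · subst hj; simp
  · simp [hj]

/-- The torus reflection through the bonds `{0, 1}` in direction `i` is the projection of
`axisRefl i 1`. [folklore] -/
theorem reflectBetweenSites_proj {N : ℕ} (i : Fin d) (x : Site d) :
    Torus.reflectBetweenSites i (0 : ZMod N) (Torus.proj N x) = Torus.proj N (axisRefl i 1 x) := by
  funext j
  simp only [Torus.reflectBetweenSites_apply, Torus.proj_apply, Function.update_apply, axisRefl_apply]
  by_cases hj : j = i
  · subst hj; simp
  · simp [hj]

/-- **Site reflection positivity of the infinite-volume two-point function (`m*(β) = 0`)**: for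
finitely many sites `U_j` with `(U_j)_i ≥ 0` and real coefficients,
`0 ≤ ∑_{j,l} c_j c_l G(U_l - θ U_j)`, `θ = axisRefl i 0` the reflection `x_i ↦ -x_i`,
`G = ⟨σ₀σ_·⟩^f_β` (limit of `torus_rp_linear_sites` along even tori). [cite: FILS1978, §2] -/
theorem twoPointFree_rp_sites {β : ℝ} (hβ : 0 ≤ β) (hm : spontaneousMagnetization d β = 0)
    (i : Fin d) {ι : Type*} (s : Finset ι) (c : ι → ℝ) (U : ι → Site d) (hU : ∀ j ∈ s, 0 ≤ U j i) :
    0 ≤ ∑ j ∈ s, ∑ l ∈ s, c j * c l * twoPointFree d β (U l - axisRefl i 0 (U j)) := by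
  classical
  set S : ℝ := ∑ j ∈ s, ∑ l ∈ s, c j * c l * twoPointFree d β (U l - axisRefl i 0 (U j)) with hS
  by_contra hneg
  push Not at hneg
  set A : ℝ := ∑ j ∈ s, ∑ l ∈ s, |c j * c l| with hA
  have hA0 : 0 ≤ A := Finset.sum_nonneg fun j _ => Finset.sum_nonneg fun l _ => abs_nonneg _
  set ε : ℝ := -S / (2 * (A + 1)) with hε
  have hε0 : 0 < ε := by rw [hε]; exact div_pos (by linarith) (by positivity)
  obtain ⟨N₀, hN₀⟩ := torus_pairs_converge hβ hm (s ×ˢ s) (fun p => axisRefl i 0 (U p.1)) (fun p => U p.2) hε0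
  -- a coordinate bound
  obtain ⟨K, hK⟩ : ∃ K : ℕ, ∀ j ∈ s, U j i ≤ K :=
    ⟨s.sup fun j => (U j i).toNat, fun j hj => by
      have := Finset.le_sup (f := fun j => (U j i).toNat) hj; omega⟩
  set N : ℕ := 2 * (N₀ + K + 1) with hN
  haveI : NeZero N := ⟨by omega⟩
  have hNeven : Even N := ⟨N₀ + K + 1, by omega⟩
  have hNN₀ : N₀ ≤ N := by omega
  -- torus positivity
  have hT := torus_rp_linear_sites (d := d) (L := N) hNeven i 0 hβ 0 s c (fun j => Torus.proj N (U j))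
    (fun j hj => proj_mem_halfThroughSites i (hU j hj) (by have := hK j hj; omega))
  simp_rw [reflectThroughSites_proj] at hT
  -- compare term by term
  have hclose : ∀ j ∈ s, ∀ l ∈ s,
      |isingTorusTwoPoint d N β 0 (Torus.proj N (axisRefl i 0 (U j))) (Torus.proj N (U l)) -
        twoPointFree d β (U l - axisRefl i 0 (U j))| ≤ ε :=
    fun j hj l hl => hN₀ N hNN₀ (j, l) (Finset.mem_product.2 ⟨hj, hl⟩)
  have hdiff : |∑ j ∈ s, ∑ l ∈ s, c j * c l *
        isingTorusTwoPoint d N β 0 (Torus.proj N (axisRefl i 0 (U j))) (Torus.proj N (U l)) - S| ≤ A * ε := by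
    rw [hS, ← Finset.sum_sub_distrib]
    refine (Finset.abs_sum_le_sum_abs _ _).trans ?_
    rw [hA, Finset.sum_mul]
    refine Finset.sum_le_sum fun j hj => ?_
    rw [← Finset.sum_sub_distrib]
    refine (Finset.abs_sum_le_sum_abs _ _).trans ?_
    rw [Finset.sum_mul]
    refine Finset.sum_le_sum fun l hl => ?_
    rw [← mul_sub, abs_mul]
    exact mul_le_mul_of_nonneg_left (hclose j hj l hl) (abs_nonneg _)
  have hAε : A * ε ≤ -S / 2 := by
    rw [hε]
    have : A * (-S / (2 * (A + 1))) = (-S / 2) * (A / (A + 1)) := by field_simp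
    rw [this]
    have hfrac : A / (A + 1) ≤ 1 := by rw [div_le_one (by positivity)]; linarith
    nlinarith
  have := (abs_le.1 hdiff).2
  linarith

/-- **Bond reflection positivity of the infinite-volume two-point function (`m*(β) = 0`)**: for
finitely many sites `U_j` with `(U_j)_i ≥ 1`, `0 ≤ ∑_{j,l} c_j c_l G(U_l - θ' U_j)` with
`θ' = axisRefl i 1` the reflection `x_i ↦ 1 - x_i` (limit of `torus_rp_linear_bonds`). [cite: FILS1978, §2] -/
theorem twoPointFree_rp_bonds {β : ℝ} (hβ : 0 ≤ β) (hm : spontaneousMagnetization d β = 0)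
    (i : Fin d) {ι : Type*} (s : Finset ι) (c : ι → ℝ) (U : ι → Site d) (hU : ∀ j ∈ s, 1 ≤ U j i) :
    0 ≤ ∑ j ∈ s, ∑ l ∈ s, c j * c l * twoPointFree d β (U l - axisRefl i 1 (U j)) := by
  classical
  set S : ℝ := ∑ j ∈ s, ∑ l ∈ s, c j * c l * twoPointFree d β (U l - axisRefl i 1 (U j)) with hS
  by_contra hneg
  push Not at hneg
  set A : ℝ := ∑ j ∈ s, ∑ l ∈ s, |c j * c l| with hA
  have hA0 : 0 ≤ A := Finset.sum_nonneg fun j _ => Finset.sum_nonneg fun l _ => abs_nonneg _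
  set ε : ℝ := -S / (2 * (A + 1)) with hε
  have hε0 : 0 < ε := by rw [hε]; exact div_pos (by linarith) (by positivity)
  obtain ⟨N₀, hN₀⟩ := torus_pairs_converge hβ hm (s ×ˢ s) (fun p => axisRefl i 1 (U p.1)) (fun p => U p.2) hε0
  obtain ⟨K, hK⟩ : ∃ K : ℕ, ∀ j ∈ s, U j i ≤ K :=
    ⟨s.sup fun j => (U j i).toNat, fun j hj => by
      have := Finset.le_sup (f := fun j => (U j i).toNat) hj; omega⟩
  set N : ℕ := 2 * (N₀ + K + 1) with hN
  haveI : NeZero N := ⟨by omega⟩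
  have hNeven : Even N := ⟨N₀ + K + 1, by omega⟩
  have hNN₀ : N₀ ≤ N := by omega
  have hT := torus_rp_linear_bonds (d := d) (L := N) hNeven i 0 hβ 0 s c (fun j => Torus.proj N (U j))
    (fun j hj => proj_mem_halfBetweenSites i (hU j hj) (by have := hK j hj; omega))
  simp_rw [reflectBetweenSites_proj] at hT
  have hclose : ∀ j ∈ s, ∀ l ∈ s,
      |isingTorusTwoPoint d N β 0 (Torus.proj N (axisRefl i 1 (U j))) (Torus.proj N (U l)) -
        twoPointFree d β (U l - axisRefl i 1 (U j))| ≤ ε :=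
    fun j hj l hl => hN₀ N hNN₀ (j, l) (Finset.mem_product.2 ⟨hj, hl⟩)
  have hdiff : |∑ j ∈ s, ∑ l ∈ s, c j * c l *
        isingTorusTwoPoint d N β 0 (Torus.proj N (axisRefl i 1 (U j))) (Torus.proj N (U l)) - S| ≤ A * ε := by
    rw [hS, ← Finset.sum_sub_distrib]
    refine (Finset.abs_sum_le_sum_abs _ _).trans ?_
    rw [hA, Finset.sum_mul]
    refine Finset.sum_le_sum fun j hj => ?_
    rw [← Finset.sum_sub_distrib]
    refine (Finset.abs_sum_le_sum_abs _ _).trans ?_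
    rw [Finset.sum_mul]
    refine Finset.sum_le_sum fun l hl => ?_
    rw [← mul_sub, abs_mul]
    exact mul_le_mul_of_nonneg_left (hclose j hj l hl) (abs_nonneg _)
  have hAε : A * ε ≤ -S / 2 := by
    rw [hε]
    have : A * (-S / (2 * (A + 1))) = (-S / 2) * (A / (A + 1)) := by field_simp
    rw [this]
    have hfrac : A / (A + 1) ≤ 1 := by rw [div_le_one (by positivity)]; linarith
    nlinarith
  have := (abs_le.1 hdiff).2
  linarith

end Infinite

/-! ### The smeared axis sequences `q^± = 2G(ke_i) ± (G(ke_i + x_⊥) + G(ke_i - x_⊥))` -/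

section Sequences

variable {d : ℕ}

/-- **Positivity and convexity of the smeared axis sequences.** For `β ≥ 0` with `m*(β) = 0`, an
axis `i`, a site `x_⊥` with `(x_⊥)_i = 0` and a sign `s = ±1`, the sequence
`q_k = 2G(ke_i) + s(G(ke_i + x_⊥) + G(ke_i - x_⊥))` — the quadratic form of reflection positivity
on `F = σ₀ + s σ_{x_⊥}` and its axis translates — satisfies `q_k ≥ 0` and
`2q_{k+1} ≤ q_k + q_{k+2}` for all `k ≥ 0` (site reflections at even, bond reflections at odd
centres). This is the tree's substitute for the spectral representation
`⟨τ₀τ_{(k,x_⊥)}⟩ = ∫₀¹ λ^k dμ(λ)` of the source. [cite: DuminilCopinPanis2025LowerBounds, footnote 2 to eq. (1.11) (spectral representation)] [cite: FILS1978, §2] -/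
theorem smeared_axis_nonneg_convex {β : ℝ} (hβ : 0 ≤ β) (hm : spontaneousMagnetization d β = 0)
    (i : Fin d) (xp : Site d) (hxp : xp i = 0) {sg : ℝ} (hsg : sg ^ 2 = 1) :
    (∀ k : ℕ, 0 ≤ 2 * twoPointFree d β (Pi.single i (k : ℤ)) +
        sg * (twoPointFree d β (Pi.single i (k : ℤ) + xp) + twoPointFree d β (Pi.single i (k : ℤ) - xp))) ∧
    (∀ k : ℕ, 2 * (2 * twoPointFree d β (Pi.single i ((k + 1 : ℕ) : ℤ)) +
        sg * (twoPointFree d β (Pi.single i ((k + 1 : ℕ) : ℤ) + xp) +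
          twoPointFree d β (Pi.single i ((k + 1 : ℕ) : ℤ) - xp))) ≤
      (2 * twoPointFree d β (Pi.single i (k : ℤ)) +
        sg * (twoPointFree d β (Pi.single i (k : ℤ) + xp) + twoPointFree d β (Pi.single i (k : ℤ) - xp))) +
      (2 * twoPointFree d β (Pi.single i ((k + 2 : ℕ) : ℤ)) +
        sg * (twoPointFree d β (Pi.single i ((k + 2 : ℕ) : ℤ) + xp) +
          twoPointFree d β (Pi.single i ((k + 2 : ℕ) : ℤ) - xp)))) := by
  classical
  -- abbreviate `q`
  set q : ℤ → ℝ := fun m => 2 * twoPointFree d β (Pi.single i m) +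
    sg * (twoPointFree d β (Pi.single i m + xp) + twoPointFree d β (Pi.single i m - xp)) with hq
  have hsg2 : sg * sg = 1 := by rw [← sq]; exact hsg
  -- geometry of the reflection `axisRefl i c₀ : y ↦ y + (c₀ - 2 y_i) e_i`
  have hR : ∀ (c₀ : ℤ) (y : Site d), axisRefl i c₀ y = y + Pi.single i (c₀ - 2 * y i) := fun c₀ y => by
    funext l; rw [Pi.add_apply, axisRefl_apply]; by_cases hl : l = i
    · subst hl; simp; ring
    · simp [hl]
  have d00 : ∀ c₀ a b : ℤ, Pi.single i b - axisRefl i c₀ (Pi.single i a) = (Pi.single i (a + b - c₀) : Site d) := by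
    intro c₀ a b; rw [hR]; funext l; by_cases hl : l = i
    · subst hl; simp; ring
    · simp [hl]
  have d01 : ∀ c₀ a b : ℤ, (Pi.single i b + xp) - axisRefl i c₀ (Pi.single i a) = (Pi.single i (a + b - c₀) : Site d) + xp := by
    intro c₀ a b; rw [hR]; funext l; by_cases hl : l = i
    · subst hl; simp [hxp]; ring
    · simp [hl]
  have d10 : ∀ c₀ a b : ℤ, Pi.single i b - axisRefl i c₀ (Pi.single i a + xp) = (Pi.single i (a + b - c₀) : Site d) - xp := by
    intro c₀ a b; rw [hR]; funext l; by_cases hl : l = i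
    · subst hl; simp [hxp]; ring
    · simp [hl]
  have d11 : ∀ c₀ a b : ℤ, (Pi.single i b + xp) - axisRefl i c₀ (Pi.single i a + xp) = (Pi.single i (a + b - c₀) : Site d) := by
    intro c₀ a b; rw [hR]; funext l; by_cases hl : l = i
    · subst hl; simp [hxp]; ring
    · simp [hl]
  -- RP with coefficient vector `γ` on translation amounts `a ∈ T`
  have hRP : ∀ (c₀ : ℤ) (T : Finset ℤ) (γ : ℤ → ℝ), (c₀ = 0 ∨ c₀ = 1) → (∀ a ∈ T, c₀ ≤ a) →
      0 ≤ ∑ a ∈ T, ∑ b ∈ T, γ a * γ b * q (a + b - c₀) := by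
    intro c₀ T γ hc₀ hT
    set U : ℤ ⊕ ℤ → Site d := Sum.elim (fun a => (Pi.single i a : Site d)) (fun a => Pi.single i a + xp) with hU
    set cc : ℤ ⊕ ℤ → ℝ := Sum.elim γ (fun a => sg * γ a) with hcc
    have hUi : ∀ p ∈ T.disjSum T, c₀ ≤ U p i := by
      intro p hp
      rcases Finset.mem_disjSum.1 hp with ⟨a, ha, rfl⟩ | ⟨a, ha, rfl⟩
      · simp [hU]; exact hT a ha
      · simp [hU, hxp]; exact hT a ha
    have hpos : 0 ≤ ∑ p ∈ T.disjSum T, ∑ p' ∈ T.disjSum T,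
        cc p * cc p' * twoPointFree d β (U p' - axisRefl i c₀ (U p)) := by
      rcases hc₀ with rfl | rfl
      · exact twoPointFree_rp_sites hβ hm i _ cc U fun p hp => hUi p hp
      · exact twoPointFree_rp_bonds hβ hm i _ cc U fun p hp => hUi p hp
    have hexp : ∑ p ∈ T.disjSum T, ∑ p' ∈ T.disjSum T,
        cc p * cc p' * twoPointFree d β (U p' - axisRefl i c₀ (U p)) =
        ∑ a ∈ T, ∑ b ∈ T, γ a * γ b * q (a + b - c₀) := by
      rw [Finset.sum_disjSum]
      simp_rw [Finset.sum_disjSum]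
      simp only [hU, hcc, Sum.elim_inl, Sum.elim_inr]
      simp_rw [d00, d01, d10, d11]
      have hrhs : ∀ a b : ℤ, γ a * γ b * q (a + b - c₀) =
          (γ a * γ b * twoPointFree d β (Pi.single i (a + b - c₀)) +
            γ a * (sg * γ b) * twoPointFree d β (Pi.single i (a + b - c₀) + xp)) +
          (sg * γ a * γ b * twoPointFree d β (Pi.single i (a + b - c₀) - xp) +
            sg * γ a * (sg * γ b) * twoPointFree d β (Pi.single i (a + b - c₀))) := by
        intro a b
        rw [hq]; simp only
        have : sg * γ a * (sg * γ b) = γ a * γ b := by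
          calc sg * γ a * (sg * γ b) = (sg * sg) * (γ a * γ b) := by ring
            _ = γ a * γ b := by rw [hsg2, one_mul]
        rw [this]; ring
      simp_rw [hrhs, Finset.sum_add_distrib]
    rw [← hexp]; exact hpos
  -- translate into `q`
  have hgoal1 : ∀ k : ℕ, 0 ≤ q k := by
    intro k
    -- even `k = 2a`: sites with `T = {a}`; odd `k = 2a + 1`: bonds with `T = {a + 1}`
    rcases Nat.even_or_odd k with ⟨a, rfl⟩ | ⟨a, rfl⟩
    · have := hRP 0 {(a : ℤ)} (fun _ => 1) (Or.inl rfl) (fun x hx => by simp at hx; omega)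
      rw [Finset.sum_singleton, Finset.sum_singleton] at this
      have e : ((a : ℤ) + a - 0) = ((a + a : ℕ) : ℤ) := by push_cast; ring
      rw [e] at this; simpa using this
    · have := hRP 1 {((a : ℤ) + 1)} (fun _ => 1) (Or.inr rfl) (fun x hx => by simp at hx; omega)
      rw [Finset.sum_singleton, Finset.sum_singleton] at this
      have e : ((a : ℤ) + 1 + (a + 1) - 1) = ((2 * a + 1 : ℕ) : ℤ) := by push_cast; ring
      rw [e] at this; simpa using this
  have hgoal2 : ∀ k : ℕ, 2 * q ((k + 1 : ℕ) : ℤ) ≤ q (k : ℤ) + q ((k + 2 : ℕ) : ℤ) := by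
    intro k
    rcases Nat.even_or_odd k with ⟨a, rfl⟩ | ⟨a, rfl⟩
    · -- sites, `T = {a, a+1}`, `γ = (1, -1)`
      have hne : (a : ℤ) ≠ (a : ℤ) + 1 := by omega
      have := hRP 0 {(a : ℤ), (a : ℤ) + 1} (fun x => if x = a then 1 else -1) (Or.inl rfl)
        (fun x hx => by simp at hx; omega)
      rw [Finset.sum_pair hne, Finset.sum_pair hne, Finset.sum_pair hne] at this
      simp only [if_true, if_neg hne.symm, sub_zero] at this
      have e1 : ((a : ℤ) + a) = ((a + a : ℕ) : ℤ) := by push_cast; ring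
      have e2 : ((a : ℤ) + (a + 1)) = ((a + a + 1 : ℕ) : ℤ) := by push_cast; ring
      have e3 : ((a : ℤ) + 1 + a) = ((a + a + 1 : ℕ) : ℤ) := by push_cast; ring
      have e4 : ((a : ℤ) + 1 + (a + 1)) = ((a + a + 2 : ℕ) : ℤ) := by push_cast; ring
      rw [e1, e2, e3, e4] at this
      linarith
    · -- bonds, `T = {a+1, a+2}`
      have hne : (a : ℤ) + 1 ≠ (a : ℤ) + 2 := by omega
      have := hRP 1 {(a : ℤ) + 1, (a : ℤ) + 2} (fun x => if x = a + 1 then 1 else -1) (Or.inr rfl)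
        (fun x hx => by simp at hx; omega)
      rw [Finset.sum_pair hne, Finset.sum_pair hne, Finset.sum_pair hne] at this
      simp only [if_true, if_neg hne.symm] at this
      have e1 : ((a : ℤ) + 1 + (a + 1) - 1) = ((2 * a + 1 : ℕ) : ℤ) := by push_cast; ring
      have e2 : ((a : ℤ) + 1 + (a + 2) - 1) = ((2 * a + 1 + 1 : ℕ) : ℤ) := by push_cast; ring
      have e3 : ((a : ℤ) + 2 + (a + 1) - 1) = ((2 * a + 1 + 1 : ℕ) : ℤ) := by push_cast; ring
      have e4 : ((a : ℤ) + 2 + (a + 2) - 1) = ((2 * a + 1 + 2 : ℕ) : ℤ) := by push_cast; ring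
      rw [e1, e2, e3, e4] at this
      linarith
  refine ⟨fun k => ?_, fun k => ?_⟩
  · have := hgoal1 k; simpa only [hq] using this
  · have := hgoal2 k; simpa only [hq] using this

end Sequences

end DCPGradient

/-! ### The gradient estimate -/

section Gradient

variable {d : ℕ}

open DCPGradient

/-- **The gradient estimate (Duminil-Copin–Panis 2025, eq. (1.11), per-step form).** For the
nearest-neighbour Ising model on `ℤ^d` at `β ≥ 0` with `m*(β) = 0`, an axis `i`, a site `x` and
`0 ≤ j ≤ x_i`:
`⟨σ₀σ_x⟩^f_β - ⟨σ₀σ_{x+e_i}⟩^f_β ≤ ⟨σ₀σ_{je_i}⟩^f_β / (x_i - j + 1)`.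
Source: "`⟨τ₀τ_{(k,x_⊥)}⟩_β - ⟨τ₀τ_{(k+1,x_⊥)}⟩_β = (1/k)∫₀¹ kλ^k(1-λ)dμ(λ)` … replacing
`kλ^k(1-λ)` by `Cλ^{k/2}`" (footnote 2); here from the convexity of the smeared axis sequences
(`smeared_axis_nonneg_convex`, reflection positivity), `sub_succ_le_div_of_convex`, and the
Messager–Miracle-Solé bound `⟨σ₀σ_{je_i + x_⊥}⟩ ≤ ⟨σ₀σ_{je_i}⟩`. [cite: DuminilCopinPanis2025LowerBounds, eq. (1.11) and footnote 2] -/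
theorem twoPointFree_gradient_estimate {β : ℝ} (hβ : 0 ≤ β) (hm : spontaneousMagnetization d β = 0)
    (i : Fin d) (x : Site d) (j : ℕ) (hj : (j : ℤ) ≤ x i) :
    twoPointFree d β x - twoPointFree d β (x + Pi.single i 1) ≤
      twoPointFree d β (Pi.single i (j : ℤ)) / ((x i : ℝ) - j + 1) := by
  classical
  have hd : 1 ≤ d := by
    rcases Nat.eq_zero_or_pos d with h0 | h0
    · subst h0; exact Fin.elim0 i
    · exact h0
  -- decompose `x = k e_i + x_⊥`
  set xp : Site d := Function.update x i 0 with hxp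
  have hxpi : xp i = 0 := by simp [hxp]
  obtain ⟨k, hk⟩ : ∃ k : ℕ, x i = k := ⟨(x i).toNat, by omega⟩
  have hx : x = Pi.single i (k : ℤ) + xp := by
    funext l; by_cases hl : l = i
    · subst hl; simp [hxp, hk]
    · simp [hxp, hl]
  have hjk : j ≤ k := by omega
  -- evenness in `x_⊥`
  have hGev_xp : ∀ m : ℕ, twoPointFree d β (Pi.single i (m : ℤ) - xp) = twoPointFree d β (Pi.single i (m : ℤ) + xp) := by
    intro m
    have habs : (fun l => |((Pi.single i (m : ℤ) : Site d) - xp) l|) = fun l => |((Pi.single i (m : ℤ) : Site d) + xp) l| := by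
      funext l
      by_cases hl : l = i
      · subst hl; simp [hxpi]
      · simp [hl]
    have h1 := twoPointFree_abs_eq hβ (Pi.single i (m : ℤ) - xp)
    have h2 := twoPointFree_abs_eq hβ (Pi.single i (m : ℤ) + xp)
    rw [habs] at h1
    exact h1.symm.trans h2
  -- reflection positivity input, then abbreviate
  obtain ⟨hp0, hpc⟩ := smeared_axis_nonneg_convex hβ hm i xp hxpi (sg := 1) (by norm_num)
  obtain ⟨hm0, hmc⟩ := smeared_axis_nonneg_convex hβ hm i xp hxpi (sg := -1) (by norm_num)
  set G : Site d → ℝ := twoPointFree d β with hG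
  -- the sequences
  set a : ℕ → ℝ := fun m => G (Pi.single i (m : ℤ)) with ha
  set b : ℕ → ℝ := fun m => G (Pi.single i (m : ℤ) + xp) with hb
  set qp : ℕ → ℝ := fun m => 2 * a m + (b m + b m) with hqp
  set qm : ℕ → ℝ := fun m => 2 * a m - (b m + b m) with hqm
  have hqp_eq : ∀ m : ℕ, 2 * G (Pi.single i (m : ℤ)) + 1 * (G (Pi.single i (m : ℤ) + xp) + G (Pi.single i (m : ℤ) - xp)) = qp m := by
    intro m; rw [hGev_xp m]; simp only [hqp, ha, hb]; ring
  have hqm_eq : ∀ m : ℕ, 2 * G (Pi.single i (m : ℤ)) + -1 * (G (Pi.single i (m : ℤ) + xp) + G (Pi.single i (m : ℤ) - xp)) = qm m := by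
    intro m; rw [hGev_xp m]; simp only [hqm, ha, hb]; ring
  have hqp0 : ∀ m, 0 ≤ qp m := fun m => by rw [← hqp_eq]; exact hp0 m
  have hqm0 : ∀ m, 0 ≤ qm m := fun m => by rw [← hqm_eq]; exact hm0 m
  have hqpc : ∀ m, 2 * qp (m + 1) ≤ qp m + qp (m + 2) := fun m => by
    rw [← hqp_eq, ← hqp_eq, ← hqp_eq]; exact hpc m
  have hqmc : ∀ m, 2 * qm (m + 1) ≤ qm m + qm (m + 2) := fun m => by
    rw [← hqm_eq, ← hqm_eq, ← hqm_eq]; exact hmc m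
  -- boundedness: `0 ≤ G ≤ 1`
  have hG1 : ∀ y, G y ≤ 1 := fun y => twoPointFree_le_one hasBoxLimit_isingCorr_free_holds hβ y
  have hG0 : ∀ y, 0 ≤ G y := fun y =>
    twoPointFree_nonneg hasBoxLimit_isingCorr_free_holds (GKSInequalities.gks_one_holds (zdGraph d)) hβ y
  have hqmB : ∀ m, qm m ≤ 2 := fun m => by
    simp only [hqm, ha, hb]; linarith [hG1 (Pi.single i (m : ℤ)), hG0 (Pi.single i (m : ℤ) + xp)]
  -- `qm` is nonincreasing, `qp` has controlled increments
  have hqm_anti : qm (k + 1) ≤ qm k := succ_le_of_convex_bdd hqmc hqmB k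
  have hqp_inc : qp k - qp (k + 1) ≤ qp j / ((k : ℝ) - j + 1) := sub_succ_le_div_of_convex hqpc hqp0 hjk
  -- `b_k - b_{k+1} = ((qp_k - qp_{k+1}) - (qm_k - qm_{k+1}))/4`
  have hbk : b k - b (k + 1) = ((qp k - qp (k + 1)) - (qm k - qm (k + 1))) / 4 := by
    simp only [hqp, hqm]; ring
  -- MMS: `b_j ≤ a_j`
  have hbj : b j ≤ a j := by
    simp only [ha, hb, hG]
    set y : Site d := Pi.single i (j : ℤ) + xp with hy
    have h1 := twoPointFree_le_axis_of_mem_sphere' hβ hd (self_mem_sphere y)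
    rw [twoPointFree_single_eq_single hβ ⟨0, hd⟩ i] at h1
    refine h1.trans ?_
    have hjn : j ≤ Site.supNorm y := by
      have := Site.natAbs_le_supNorm y i
      have hyi : y i = j := by simp [hy, hxpi]
      rw [hyi] at this; simpa using this
    obtain ⟨m, hm'⟩ : ∃ m : ℕ, Site.supNorm y = j + m := ⟨Site.supNorm y - j, by omega⟩
    rw [hm']
    have := twoPointFree_add_single_le hβ (Pi.single i (j : ℤ)) i (by simp) m
    rwa [← Pi.single_add, show ((j : ℤ) + (m : ℤ)) = ((j + m : ℕ) : ℤ) by push_cast; ring] at this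
  -- assemble
  have hden : (0 : ℝ) < (k : ℝ) - j + 1 := by
    have : (j : ℝ) ≤ k := by exact_mod_cast hjk
    linarith
  have hxi : ((x i : ℤ) : ℝ) = (k : ℝ) := by rw [hk]; rfl
  rw [hxi]
  have hlhs : G x - G (x + Pi.single i 1) = b k - b (k + 1) := by
    simp only [hb]
    rw [hx, add_right_comm, ← Pi.single_add]
    push_cast; rfl
  rw [hlhs, hbk]
  have hqpj : qp j = 2 * a j + 2 * b j := by simp only [hqp]; ring
  calc ((qp k - qp (k + 1)) - (qm k - qm (k + 1))) / 4 ≤ (qp k - qp (k + 1)) / 4 := by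
        linarith
    _ ≤ (qp j / ((k : ℝ) - j + 1)) / 4 := by linarith
    _ = (2 * a j + 2 * b j) / 4 / ((k : ℝ) - j + 1) := by rw [hqpj]; ring
    _ ≤ a j / ((k : ℝ) - j + 1) := by
        refine div_le_div_of_nonneg_right ?_ hden.le
        linarith
    _ = G (Pi.single i (j : ℤ)) / ((k : ℝ) - j + 1) := by rw [ha]

/-- **The gradient estimate at `β_c` in `d ≥ 3`** (where `m*(β_c) = 0`,
`spontaneousMagnetization_criticalBeta_eq_zero_holds`): hypothesis (H2) of
`Literature.Barriers.CriticalPhenomena.NNIsing.not_bubbleCondition_of_dcp`.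
[cite: DuminilCopinPanis2025LowerBounds, eq. (1.11) and footnote 2] -/
theorem twoPointFree_criticalBeta_gradient_estimate (hd : 3 ≤ d) (i : Fin d) (x : Site d) (j : ℕ)
    (hj : (j : ℤ) ≤ x i) :
    twoPointFree d (criticalBeta d) x - twoPointFree d (criticalBeta d) (x + Pi.single i 1) ≤
      twoPointFree d (criticalBeta d) (Pi.single i (j : ℤ)) / ((x i : ℝ) - j + 1) :=
  twoPointFree_gradient_estimate (criticalBeta_nonneg d)
    (spontaneousMagnetization_criticalBeta_eq_zero_holds hd) i x j hj

end Gradient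

end Literature.Probability.LatticeModels
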